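import Mathlib
import Literature.Computability.Complexity.RandomKSatEnsembleOGP

/-!
# Route OverlapGapAlgebra, crux `SearchHardWindow` (stmt-PneNP-2460): semigroup identity of the
# `ε`-resampling kernel

On a finite product space `ι → Γ` (uniform measure on `Γ`) the `ε`-resampling kernel
`P_ε(y, y') = ∏_i ((1 − ε)·[y i = y' i] + ε/|Γ|)` (`resampleKernel` of
`Literature/Computability/Complexity/RandomKSatEnsembleOGP.lean`; O'Donnell 2014 Def. 8.26,
Huang–Sellke 2025 §3.3) satisfies the Chapman–Kolmogorov / semigroup identity
`Σ_{y''} P_ε(y, y'') · P_ε'(y'', y') = P_{1 − (1−ε)(1−ε')}(y, y')`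
(O'Donnell 2014 §8.1: `T_ρ T_ρ' = T_{ρ ρ'}` with `ρ = 1 − ε`). The identity is purely algebraic —
no sign or size constraint on `ε, ε'`.

Proof (`stub_kernelSemigroup`): the summand is the coordinatewise product
`∏_i f_i(y'' i)` with `f_i(c) = ((1−ε)[y i = c] + ε/q)·((1−ε')[c = y' i] + ε'/q)`, `q = |Γ|`
(`Finset.prod_mul_distrib`), so the sum over `y''` factors as `∏_i Σ_c f_i(c)`
(`Fintype.prod_sum`); and in one coordinate (`ksg_coord_sum`)
`Σ_c ((1−ε)[a = c] + ε/q)((1−ε')[c = b] + ε'/q) = (1−ε)(1−ε')[a = b] + (ε + ε' − εε')/q`,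
because `Σ_c [a = c][c = b] = [a = b]`, `Σ_c [a = c] = Σ_c [c = b] = 1`, `Σ_c 1/q² = 1/q`, and
`(1−ε)ε' + ε(1−ε') + εε' = ε + ε' − εε' = 1 − (1−ε)(1−ε')`.
-/

set_option linter.dupNamespace false -- `Summit.PneNP.PneNP.…`: summit = sub-problem

namespace Summit.PneNP.PneNP.Theorems

open Finset
open Literature.Computability.Complexity
open scoped Classical

/-- One coordinate of the semigroup identity of the resampling kernel (`q = |Γ| > 0`):
`Σ_{c : Γ} ((1 − ε)·[a = c] + ε/q)·((1 − ε')·[c = b] + ε'/q)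
  = (1 − (1 − (1−ε)(1−ε')))·[a = b] + (1 − (1−ε)(1−ε'))/q`. -/
theorem ksg_coord_sum {Γ : Type*} [Fintype Γ] [DecidableEq Γ] [Nonempty Γ] (ε ε' : ℝ)
    (a b : Γ) :
    ∑ c : Γ, ((1 - ε) * (if a = c then (1 : ℝ) else 0) + ε / Fintype.card Γ) *
        ((1 - ε') * (if c = b then (1 : ℝ) else 0) + ε' / Fintype.card Γ) =
      (1 - (1 - (1 - ε) * (1 - ε'))) * (if a = b then (1 : ℝ) else 0) +
        (1 - (1 - ε) * (1 - ε')) / Fintype.card Γ := by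
  have hcard : (Fintype.card Γ : ℝ) ≠ 0 := by
    exact_mod_cast (Fintype.card_pos (α := Γ)).ne'
  simp only [add_mul, mul_add, Finset.sum_add_distrib]
  simp only [mul_ite, mul_one, mul_zero, ite_mul, zero_mul, Finset.sum_ite_eq, Finset.sum_ite_eq',
    Finset.mem_univ, if_true, Finset.sum_const, Finset.card_univ, nsmul_eq_mul]
  split_ifs <;> field_simp <;> ring

/-- **Semigroup (Chapman–Kolmogorov) identity of the `ε`-resampling kernel** on the finite product
space `ι → Γ` (O'Donnell 2014 §8.1, `T_ρ T_ρ' = T_{ρρ'}`, `ρ = 1 − ε`; the Markov property of the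
resampling chain of Huang–Sellke 2025 §3.3.2):
`Σ_{y''} P_ε(y, y'') · P_ε'(y'', y') = P_{1 − (1−ε)(1−ε')}(y, y')`, for all real `ε, ε'`. -/
theorem stub_kernelSemigroup {ι Γ : Type*} [Fintype ι] [DecidableEq ι] [Fintype Γ] [DecidableEq Γ]
    [Nonempty Γ] (ε ε' : ℝ) (y y' : ι → Γ) :
    ∑ y'' : ι → Γ, resampleKernel ε y y'' * resampleKernel ε' y'' y' =
      resampleKernel (1 - (1 - ε) * (1 - ε')) y y' := by
  have hmul : ∀ y'' : ι → Γ, resampleKernel ε y y'' * resampleKernel ε' y'' y' =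
      ∏ i, (((1 - ε) * (if y i = y'' i then (1 : ℝ) else 0) + ε / Fintype.card Γ) *
        ((1 - ε') * (if y'' i = y' i then (1 : ℝ) else 0) + ε' / Fintype.card Γ)) := by
    intro y''
    unfold resampleKernel
    rw [← Finset.prod_mul_distrib]
  simp_rw [hmul]
  rw [← Fintype.prod_sum (fun i (c : Γ) =>
      ((1 - ε) * (if y i = c then (1 : ℝ) else 0) + ε / Fintype.card Γ) *
        ((1 - ε') * (if c = y' i then (1 : ℝ) else 0) + ε' / Fintype.card Γ))]
  unfold resampleKernel
  exact Finset.prod_congr rfl fun i _ => ksg_coord_sum ε ε' (y i) (y' i)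

end Summit.PneNP.PneNP.Theorems
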